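import Summits.BirchSwinnertonDyer.BirchSwinnertonDyer.Theorems.CumulativeHeegnerLeopoldtCumulativeHeegnerInclusionAtThreeMuHalfOfResidualFinite
import Summits.BirchSwinnertonDyer.BirchSwinnertonDyer.Theorems.UniversalToricDescentLambdaNormProfile
import HarnessLib

/-!
# Route `CumulativeHeegnerLeopoldt`, crux K2 `EisensteinCharacterInvariantsAtThree` (stmt-BirchSwinnertonDyer-24199),
# line `birth` (skeleton `7ff6adfe04f0…`): the ALGEBRAIC HALF `stub_algebraicLambdaMuZero` FROM RESIDUAL-SELMER
# FINITENESS (K1-line stub B1 `stub_residualSelmerFinite`) — HELPER (`--supports 24199`), lead prover bsd-line-chl-p1 g7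

The K2 line composes `EisensteinCharacterInvariantsAtThree` (char `X_{∅,0}` principal, `μ = 0` on both sides, same
`λ`) from `stub_algebraicLambdaMuZero` (the algebraic half: `Ch_Λ(X_{∅,0})·R₀⟦T⟧ = (g)` with `g` of NORM PROFILE `n` —
no unit coefficient below `n`, a unit coefficient at `n`, i.e. `μ_alg = 0` and `λ_alg = n`), `stub_analyticMuZero` and
`stub_lambdaComparison`. The refuter vet (bsd-vet-tk5h g6, evidence `W6.lean` §d on 24198/24199) kernel-checked in a
scratch namespace that the K1-line's registered stub B1 (`stub_residualSelmerFinite`: on the Leopoldt cell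
`Sel_{𝔭′}(K_∞, E[3^∞])[3]` is finite) already delivers the algebraic half («DEDUP: K2's stub_algebraicLambdaMuZero … =
same print item, import the B1 port by name»). This file LANDS that bridge as importable theorems, with the profile
index PINNED to the intrinsic `λ`-invariant of the constructed dual:

* §1 `isTorsion_and_normProfile_lambdaInvariant_of_residualFinite` — for ANY elliptic `W/ℚ`, number field `K`,
  `ℤ₃`-extension `κ` with topological generator `γ` and prime `𝔭′` of `K`: `Sel_{𝔭′}(K_∞, E[3^∞])[3]` finite ⟹
  `X = X_ac(E[3^∞])` (strict at `𝔭′`, `Σ = ∅`) is `Λ`-torsion and `Ch_Λ(X)·R₀⟦T⟧ = (g)` with `g` of norm profile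
  `λ(X)` (p606940 §1 = Greenberg's criterion, then UTD's `normProfile_lambdaInvariant_of_exists_unit_coeff` =
  Weierstrass preparation, Washington §13.2); `isTorsion_and_muInvariant_eq_zero_of_residualFinite` — the same read
  as `X` torsion with `μ(X) = 0`; `lambdaInvariant_eq_of_residualFinite_of_normProfile` — any generator's profile
  index IS `λ(X)`.
* §2 `stub_algebraicLambdaMuZero_of_stub_residualSelmerFinite` — the K2-line's registered stub (signature VERBATIM
  as conclusion) from the K1-line's registered stub B1 (signature VERBATIM as hypothesis); the frame binders
  (`Dt, γ`-clauses at `𝔭`, `ι′, Ω_K, Ω_p, L`, the BDP property, `r_an = 1`) are idle.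

So once B1 lands (width seat bsd-line-chl-k1-p1-w2: CGLS 2022 §3 port, Kummer step landed in
`…StubResidualSelmerFiniteReductions`), the K2 line's algebraic stub closes BY NAME and K2's remaining content is
`stub_analyticMuZero` (μ(ℒ_𝔭^{BDP}) = 0) and the inequality `λ_an ≤ λ_alg` of `stub_lambdaComparison` (its other half
`λ_alg ≤ λ_an` is free under K1, companion file `…LambdaComparisonHalfOfInclusion`).

THEOREMS ONLY; no definition, no named fact, no `sorry`; nothing is asserted about B1. BSD is not proved by any of this.

References: [GreenbergLNM1716] §1 p. 60 (Greenberg's criterion); [Washington1997] §13.2 (μ, λ, distinguished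
polynomials); [CastellaGrossiLeeSkinner2022] §3 Prop. 3.2.1 / Thm. 3.2.8 shape (arXiv:2008.02571 §1) — shape only.
-/

set_option autoImplicit false
set_option linter.dupNamespace false -- `Summit.BirchSwinnertonDyer.BirchSwinnertonDyer.Theorems.…` (summit = sub)

noncomputable section

open scoped Classical

namespace Summit.BirchSwinnertonDyer.BirchSwinnertonDyer.Theorems.EisensteinCharacterInvariantsAtThreeAlgebraicHalf

open PowerSeries NumberField IsDedekindDomain Field
  Literature.NumberTheory.EllipticCurves Literature.NumberTheory.GaloisRepresentations
  Summit.BirchSwinnertonDyer.Rank1Residual.X11b Summit.BirchSwinnertonDyer.Rank1Residual.X11b.AcSelmer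
  Summit.BirchSwinnertonDyer.BirchSwinnertonDyer.Theorems.UniversalToricDescentAcDualMuZero
  Summit.BirchSwinnertonDyer.BirchSwinnertonDyer.Theorems.UniversalToricDescentLambdaNormProfile
  Summit.BirchSwinnertonDyer.BirchSwinnertonDyer.Theorems.CumulativeHeegnerInclusionAtThreeMuHalf

/-! ### §1 Residual finiteness ⟹ torsion, `μ = 0`, and a generator of norm profile `λ(X)` -/

/-- **Residual finiteness ⟹ `X_{∅,0}(𝔭′)` torsion and `Ch·R₀⟦T⟧ = (g)` with `g` of norm profile `λ(X)`.** For an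
elliptic `W/ℚ`, a number field `K`, a `ℤ₃`-extension `κ` of `K` with topological generator `γ` and a prime `𝔭′` of
`K`: if `Sel_{𝔭′}(K_∞, E[3^∞])[3]` is finite then `X = X_ac(E[3^∞])` (strict at `𝔭′`, `Σ = ∅`) is `Λ`-torsion and
`Ch_Λ(X)·R₀⟦T⟧ = (g)` for some `g ∈ R₀⟦T⟧` with `‖g_i‖ < 1` for `i < λ(X)` and `‖g_{λ(X)}‖ = 1`.
[cite: GreenbergLNM1716, §1 p. 60] [cite: Washington1997, §13.2] -/
theorem isTorsion_and_normProfile_lambdaInvariant_of_residualFinite (W : WeierstrassCurve ℚ) [W.IsElliptic]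
    (K : Type) [Field K] [NumberField K] (κ : ZpExtension K 3) (γ : absoluteGaloisGroup K)
    [Fact (κ.IsTopGenerator γ)] (𝔭' : HeightOneSpectrum (𝓞 K))
    (hfin : Set.Finite {s : selmerAc (W.baseChange K) 3 κ 𝔭' ∅ | (3 : ℕ) • s = 0}) :
    Module.IsTorsion (IwasawaAlgebra 3) (XAc (W.baseChange K) 3 κ 𝔭' ∅ γ) ∧
      ∃ g : UnrSeries 3,
        (XAc.charIdeal (W.baseChange K) 3 κ 𝔭' ∅ γ).map (PowerSeries.map (Halves.toUnr 3)) = Ideal.span {g} ∧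
          (∀ i < lambdaInvariant 3 (XAc (W.baseChange K) 3 κ 𝔭' ∅ γ),
            ‖((PowerSeries.coeff i g : unrIntegers 3) : ℂ_[3])‖ < 1) ∧
          ‖((PowerSeries.coeff (lambdaInvariant 3 (XAc (W.baseChange K) 3 κ 𝔭' ∅ γ)) g : unrIntegers 3) :
            ℂ_[3])‖ = 1 := by
  haveI : (W.baseChange K).IsElliptic := inferInstanceAs (W.map (algebraMap ℚ K)).IsElliptic
  obtain ⟨hT, g, n, hg, hn⟩ := isTorsion_and_charPrincipalMuZero_of_residualFinite W K κ γ 𝔭' hfin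
  exact ⟨hT, g, hg, normProfile_lambdaInvariant_of_exists_unit_coeff (W.baseChange K) 3 κ 𝔭' ∅ γ
    Set.finite_empty hT hg ⟨n, hn⟩⟩

/-- **Residual finiteness ⟹ `X_{∅,0}(𝔭′)` is `Λ`-torsion with `μ(X) = 0`** (the literal "torsion and `μ_alg = 0`"
reading of the same criterion: a generator of `Ch·R₀⟦T⟧` with a norm-one coefficient forces `μ = 0`, UTD's
`muInvariant_eq_zero_of_map_charIdeal_eq_span`). [cite: GreenbergLNM1716, §1 p. 60] [cite: Washington1997, §13.2] -/
theorem isTorsion_and_muInvariant_eq_zero_of_residualFinite (W : WeierstrassCurve ℚ) [W.IsElliptic]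
    (K : Type) [Field K] [NumberField K] (κ : ZpExtension K 3) (γ : absoluteGaloisGroup K)
    [Fact (κ.IsTopGenerator γ)] (𝔭' : HeightOneSpectrum (𝓞 K))
    (hfin : Set.Finite {s : selmerAc (W.baseChange K) 3 κ 𝔭' ∅ | (3 : ℕ) • s = 0}) :
    Module.IsTorsion (IwasawaAlgebra 3) (XAc (W.baseChange K) 3 κ 𝔭' ∅ γ) ∧
      muInvariant 3 (XAc (W.baseChange K) 3 κ 𝔭' ∅ γ) = 0 := by
  haveI : (W.baseChange K).IsElliptic := inferInstanceAs (W.map (algebraMap ℚ K)).IsElliptic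
  haveI := XAc.module_finite κ 𝔭' (∅ : Set (HeightOneSpectrum (𝓞 K))) γ Set.finite_empty (W := W.baseChange K)
  obtain ⟨hT, g, n, hg, hn⟩ := isTorsion_and_charPrincipalMuZero_of_residualFinite W K κ γ 𝔭' hfin
  exact ⟨hT, muInvariant_eq_zero_of_map_charIdeal_eq_span (XAc (W.baseChange K) 3 κ 𝔭' ∅ γ) hT hg ⟨n, hn⟩⟩

/-- **Under residual finiteness every norm-profile index of every generator of `Ch·R₀⟦T⟧` is `λ(X)`** — so the
index `n` produced by the K2-line's algebraic stub is intrinsic (UTD's `lambdaInvariant_eq_of_generator_normProfile`).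
[cite: Washington1997, §13.2] -/
theorem lambdaInvariant_eq_of_residualFinite_of_normProfile (W : WeierstrassCurve ℚ) [W.IsElliptic]
    (K : Type) [Field K] [NumberField K] (κ : ZpExtension K 3) (γ : absoluteGaloisGroup K)
    [Fact (κ.IsTopGenerator γ)] (𝔭' : HeightOneSpectrum (𝓞 K))
    (hfin : Set.Finite {s : selmerAc (W.baseChange K) 3 κ 𝔭' ∅ | (3 : ℕ) • s = 0})
    {g : UnrSeries 3} {n : ℕ}
    (hg : (XAc.charIdeal (W.baseChange K) 3 κ 𝔭' ∅ γ).map (PowerSeries.map (Halves.toUnr 3)) = Ideal.span {g})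
    (hgn : (∀ i < n, ‖((PowerSeries.coeff i g : unrIntegers 3) : ℂ_[3])‖ < 1) ∧
      ‖((PowerSeries.coeff n g : unrIntegers 3) : ℂ_[3])‖ = 1) :
    lambdaInvariant 3 (XAc (W.baseChange K) 3 κ 𝔭' ∅ γ) = n := by
  haveI : (W.baseChange K).IsElliptic := inferInstanceAs (W.map (algebraMap ℚ K)).IsElliptic
  obtain ⟨hT, hμ⟩ := isTorsion_and_muInvariant_eq_zero_of_residualFinite W K κ γ 𝔭' hfin
  exact lambdaInvariant_eq_of_generator_normProfile (W.baseChange K) 3 κ 𝔭' ∅ γ Set.finite_empty hT hμ hg hgn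

/-! ### §2 The K2-line's registered stub `stub_algebraicLambdaMuZero` from the K1-line's registered stub B1 -/

/-- **K2-line stub `stub_algebraicLambdaMuZero` (skeleton `7ff6adfe04f0…`, signature VERBATIM as conclusion) from
K1-line stub B1 `stub_residualSelmerFinite` (skeleton `f4498654b697668f`, signature VERBATIM as hypothesis `hB1`).**
On the Leopoldt cell at every frame, `Ch_Λ(X_{∅,0}(𝔭′))·R₀⟦T⟧ = (g)` with `g` of norm profile `n` (in fact
`n = λ(X_{∅,0}(𝔭′))`, §1), granted residual-Selmer finiteness on the cell; the frame binders `Dt`, the clauses on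
`𝔭`, `ι′, Ω_K, Ω_p, L`, the BDP property and `r_an = 1` are idle. Nothing is asserted about B1.
[cite: GreenbergLNM1716, §1 p. 60] [cite: Washington1997, §13.2] -/
theorem stub_algebraicLambdaMuZero_of_stub_residualSelmerFinite
    (hB1 : ∀ (W : WeierstrassCurve ℚ) [W.IsElliptic] [W.IsGloballyMinimal] (N : ℕ) [NeZero N] (K : Type) [Field K] [NumberField K], Summit.BirchSwinnertonDyer.Rank1Residual.Additive.ClassO6 W 3 → Literature.NumberTheory.EllipticCurves.Rank1Residual.Red W 3 → (∃ Φ : AddSubgroup (WeierstrassCurve.geomTorsion W ((3 : ℕ) : ℤ)), Literature.NumberTheory.EllipticCurves.Rank1Residual.IsRationalLine W 3 Φ ∧ ∀ (v : IsDedekindDomain.HeightOneSpectrum (NumberField.RingOfIntegers ℚ)), ((3 : ℕ) : NumberField.RingOfIntegers ℚ) ∈ v.asIdeal → ∀ 𝔓 ∈ v.primesAbove, ¬ (∀ g ∈ 𝔓.decompositionSubgroup (Field.absoluteGaloisGroup ℚ), ∀ P ∈ Φ, g • P = P) ∧ ¬ (∀ g ∈ 𝔓.decompositionSubgroup (Field.absoluteGaloisGroup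 ℚ), ∀ P : WeierstrassCurve.geomTorsion W ((3 : ℕ) : ℤ), g • P - P ∈ Φ)) → W.conductorNorm ℤ = N → Literature.NumberTheory.EllipticCurves.IsImaginaryQuadratic K → Literature.NumberTheory.EllipticCurves.SatisfiesHeegnerHypothesis N K → ∀ (κ : Literature.NumberTheory.EllipticCurves.ZpExtension K 3), κ.IsAnticyclotomic → ∀ (𝔭' : IsDedekindDomain.HeightOneSpectrum (NumberField.RingOfIntegers K)), ((3 : ℕ) : NumberField.RingOfIntegers K) ∈ 𝔭'.asIdeal → Set.Finite {s : Summit.BirchSwinnertonDyer.Rank1Residual.X11b.AcSelmer.selmerAc (W.baseChange K) 3 κ 𝔭' ∅ | (3 : ℕ) • s = 0}) :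
    ∀ (W : WeierstrassCurve ℚ) [W.IsElliptic] [W.IsGloballyMinimal] (N : ℕ) [NeZero N] (K : Type) [Field K] [NumberField K] (Dt : Literature.NumberTheory.EllipticCurves.ModularForms.ModularParametrizationData W N), Summit.BirchSwinnertonDyer.Rank1Residual.Additive.ClassO6 W 3 → Literature.NumberTheory.EllipticCurves.Rank1Residual.Red W 3 → (∃ Φ : AddSubgroup (WeierstrassCurve.geomTorsion W ((3 : ℕ) : ℤ)), Literature.NumberTheory.EllipticCurves.Rank1Residual.IsRationalLine W 3 Φ ∧ ∀ (v : IsDedekindDomain.HeightOneSpectrum (NumberField.RingOfIntegers ℚ)), ((3 : ℕ) : NumberField.RingOfIntegers ℚ) ∈ v.asIdeal → ∀ 𝔓 ∈ v.primesAbove, ¬ (∀ g ∈ 𝔓.decompositionSubgroup (Field.absoluteGaloisGroup ℚ), ∀ P ∈ Φ, g • P = P) ∧ ¬ (∀ g ∈ 𝔓.decompositionSubgroup (Field.absoluteGaloisGroup ℚ), ∀ P : WeierstrassCurve.geomTorsion W ((3 : ℕ) : ℤ), g • P - P ∈ Φ)) → W.analyticRank = 1 → W.conductorNorm ℤ = N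 → Literature.NumberTheory.EllipticCurves.IsImaginaryQuadratic K → Literature.NumberTheory.EllipticCurves.SatisfiesHeegnerHypothesis N K → ∀ (κ : Literature.NumberTheory.EllipticCurves.ZpExtension K 3), κ.IsAnticyclotomic → ∀ (γ : Field.absoluteGaloisGroup K) [Fact (κ.IsTopGenerator γ)] (𝔭 : IsDedekindDomain.HeightOneSpectrum (NumberField.RingOfIntegers K)), ((3 : ℕ) : NumberField.RingOfIntegers K) ∈ 𝔭.asIdeal → 𝔭.asIdeal.ramificationIdx (NumberField.RingOfIntegers ℚ) = 1 → 𝔭.asIdeal.inertiaDeg (NumberField.RingOfIntegers ℚ) = 1 → ∀ (𝔭' : IsDedekindDomain.HeightOneSpectrum (NumberField.RingOfIntegers K)), ((3 : ℕ) : NumberField.RingOfIntegers K) ∈ 𝔭'.asIdeal → 𝔭' ≠ 𝔭 → ∀ (ι' : PadicAlgCl 3 ≃+* ℂ), Summit.BirchSwinnertonDyer.BirchSwinnertonDyer.Theorems.SchneiderFree.BranchInducesPrime 3 ι' 𝔭 → ∀ (ΩK : ℂ) (Ωp : ℂ_[3]) (L : Literature.NumberTheory.EllipticCurves.UnrSeries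 3), ΩK ≠ 0 → Ωp ≠ 0 → Literature.NumberTheory.EllipticCurves.IsBDPLFunction ι' 𝔭 κ γ Dt.f ΩK Ωp L → ∃ (g : Literature.NumberTheory.EllipticCurves.UnrSeries 3) (n : ℕ), (Summit.BirchSwinnertonDyer.Rank1Residual.X11b.AcSelmer.XAc.charIdeal (W.baseChange K) 3 κ 𝔭' ∅ γ).map (PowerSeries.map (Summit.BirchSwinnertonDyer.Rank1Residual.X11b.Halves.toUnr 3)) = Ideal.span {g} ∧ (∀ i < n, ‖((PowerSeries.coeff i g : Literature.NumberTheory.EllipticCurves.unrIntegers 3) : ℂ_[3])‖ < 1) ∧ ‖((PowerSeries.coeff n g : Literature.NumberTheory.EllipticCurves.unrIntegers 3) : ℂ_[3])‖ = 1 := by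
  intro W _ _ N _ K _ _ _Dt hO6 hRed hcell _hr hN hK hHg κ hκ γ _ 𝔭 _h𝔭 _he _hf 𝔭' h𝔭' _hne _ι' _hι _ΩK _Ωp _L
    _hΩK _hΩp _hBDP
  obtain ⟨_, g, hg, hprof⟩ := isTorsion_and_normProfile_lambdaInvariant_of_residualFinite W K κ γ 𝔭'
    (hB1 W N K hO6 hRed hcell hN hK hHg κ hκ 𝔭' h𝔭')
  exact ⟨g, _, hg, hprof⟩

end Summit.BirchSwinnertonDyer.BirchSwinnertonDyer.Theorems.EisensteinCharacterInvariantsAtThreeAlgebraicHalf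

end
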